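/-
Copyright (c) 2026. All rights reserved.
Released under Apache 2.0 license as described in the file LICENSE.
Authors: abc-iut cell, seat abc-iut-f-069 (gen 3; the `iii″` closer at constructed data promised to abc-iut-L4-t6, RULING #8e).
-/
import Literature.AnabelianGeometry.AbsoluteAnabelian.AbsTopII.DPSCInertiaOfOuterActionZhat
import Literature.AnabelianGeometry.AbsoluteAnabelian.AbsTopII.InertiaGroupsCuspScopeProofs

/-!
# [AbsTopII] Prop 1.3 (iii) with the printed `Π_𝔾`-scope (`Prop_1_3_iii″`) at the CONSTRUCTED DPSC data

S. Mochizuki, *Topics in Absolute Anabelian Geometry II* [AbsTopII] (bib `MochizukiAbsTopII2013`; kurims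
manuscript `paper:url-585b8d0ad0d9`), §1 Def 1.2 (ii) p. 10 ("determines [up to conjugation in `Π_𝔾`]"),
Prop 1.3 (iii) p. 11.

PROOF-ONLY (no definition).  abc-iut-L4-t6's `DPSCIndexData.Prop_1_3_iii''` (`AbsTopII/InertiaGroupsCuspScope.lean`,
p442458: the cusp clause asks for a `Π_𝔾`-conjugate `γI_{v(e)}γ⁻¹`, `γ ∈ Π_𝔾`) and its closer
`prop_1_3_iii''_of_branch` (`…CuspScopeProofs.lean`; branch input `∃ γ ∈ Π_𝔾, Π_e ⊆ γΠ_{v(e)}γ⁻¹`) meet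
abc-iut-f-069's `cuspSub_le_conj_vertSub_ofEmbedding` (p439117), whose output is VERBATIM that branch input
(L3's `PSCDatum.cuspGp_le` produces the conjugator in `Π_𝒢`).  PROVED here:
* `DPSCIndexData.prop_1_3_iii''_ofEmbedding` — `Prop_1_3_iii″` at every embedded datum from {F-0438,
  Rmk 1.1.3 slimness, "`I_v ↠ I`", "`I_v ≅ Ẑ^Σ`"};
* `DPSCIndexData.prop_1_3_iii''_ofOuterAction_of_dehn` — `Prop_1_3_iii″` at `Π_𝒢 ⋊^out_θ J` from
  hypotheses on the construction data only: F-0438, Rmk 1.1.3, Π_v-fixing lifts of `ρ_I` (abc-iut-w5-d226's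
  `Iv_sup_PiG_eq_PiI_ofOuterAction`), `I` closed with `I ≅ Ẑ^Σ` (`isFreeProSigmaCyclic_Iv_ofOuterAction`).
HONEST FRAMING: assembly; the named inputs stay hypotheses (typed ≠ proved); nothing here bears on
[IUTchIII] Cor 3.12 or takes a side on any author.
-/

noncomputable section

open scoped Pointwise

namespace Literature.AnabelianGeometry.AbsoluteAnabelian

open Literature.AlgebraicGeometry.Frobenioids (IsSlimGroup)
open Literature.AnabelianGeometry.EtaleTheta (contMulAut mem_contMulAut TopOut innerContAut innerAut)
open Literature.AnabelianGeometry.SemiGraphs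
open Literature.AnabelianGeometry.Anabelioids (IsSigmaInteger)
open Topology

universe u

namespace AbsTopII.DPSCIndexData

section Embedding

variable {P : Type u} [Group P] [TopologicalSpace P] [CompactSpace P]
  (G : PSCDatum P) (E : ProfiniteGrp.{u}) (ι : P →* E) (hιc : Continuous ι)
  (hιi : Function.Injective ι) (hιr : IsClosed (ι.range : Set E)) (hιn : ι.range.Normal)
  (PiI : Subgroup E) (hIn : PiI.Normal) (hle : ι.range ≤ PiI)
  (σ : G.graph.N → ℕ) (hσ : ∀ e, IsSigmaInteger G.Sigma (σ e))

include hιc hιi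

/-- **[AbsTopII] Prop 1.3 (iii) (rest) WITH THE PRINTED `Π_𝔾`-SCOPE (`Prop_1_3_iii″`) at every embedded
datum**, from [CombGC] Prop 1.2 (ii) for `G` (F-0438), slimness of the verticial subgroups (Rmk 1.1.3),
"`I_v ↠ I`" and "`I_v ≅ Ẑ^Σ`" — the `Π_𝔾`-conjugate of the cusp clause being L3's branch datum
(`cuspSub_le_conj_vertSub_ofEmbedding`) fed to abc-iut-L4-t6's `prop_1_3_iii''_of_branch`.
[cite: MochizukiAbsTopII2013, Prop 1.3 (iii) p.11] [cite: MochizukiCombGC2007, Prop 1.2 p.8] -/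
theorem prop_1_3_iii''_ofEmbedding
    (hCT : G.VerticialEdgeLikeCommensurablyTerminal) (hslimv : ∀ w, IsSlimGroup ↥(G.vertGp w))
    (hsurj : ∀ v, (DPSCData.ofEmbedding G E ι hιr hιn PiI hIn hle).Iv v ⊔
      (DPSCData.ofEmbedding G E ι hιr hιn PiI hIn hle).PiG = (DPSCData.ofEmbedding G E ι hιr hιn PiI hIn hle).PiI)
    (hcyc : ∀ v, IsFreeProSigmaCyclic G.Sigma ↥((DPSCData.ofEmbedding G E ι hιr hιn PiI hIn hle).Iv v)) :
    Literature.AnabelianGeometry.AbsoluteAnabelian.AbsTopII.DPSCIndexData.Prop_1_3_iii''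
      (ofEmbedding G E ι hιr hιn PiI hIn hle σ hσ) := by
  obtain ⟨e, he⟩ := DPSCData.exists_rangeEquiv G E ι hιr hιn PiI hIn hle hιc hιi
  have hslim' : ∀ w, IsSlimGroup
      ↥((G.mapAlong e.toMulEquiv.toMonoidHom e.continuous G.Sigma subset_rfl G.sigma_nonempty
        (G.proSigma.of_continuousMulEquiv e)).vertGp w) := fun w => by
    rw [PSCDatum.mapAlong_vertGp]
    exact DPSCData.isSlimGroup_map_continuousMulEquiv e (hslimv w)
  refine (ofEmbedding G E ι hιr hιn PiI hIn hle σ hσ).prop_1_3_iii''_of_branch ?_ ?_ ?_ hsurj hcyc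
    (DPSCData.cuspSub_le_conj_vertSub_ofEmbedding G E ι hιr hιn PiI hIn hle)
  · exact (DPSCData.ofEmbedding G E ι hιr hιn PiI hIn hle).isCommensurablyTerminal_vertSub_of_psc
      (G.mapAlong e.toMulEquiv.toMonoidHom e.continuous G.Sigma subset_rfl G.sigma_nonempty
        (G.proSigma.of_continuousMulEquiv e))
      Equiv.ulift (DPSCData.vertSub_presentation G E ι hιr hιn PiI hIn hle he)
      ((PSCDatum.verticialEdgeLikeCommensurablyTerminal_mapAlong_equiv_iff G e _ _ _ _).mpr hCT)
  · exact (DPSCData.ofEmbedding G E ι hιr hιn PiI hIn hle).isCommensurablyTerminal_cuspSub_of_psc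
      (G.mapAlong e.toMulEquiv.toMonoidHom e.continuous G.Sigma subset_rfl G.sigma_nonempty
        (G.proSigma.of_continuousMulEquiv e))
      Equiv.ulift (DPSCData.cuspSub_presentation G E ι hιr hιn PiI hIn hle he)
      ((PSCDatum.verticialEdgeLikeCommensurablyTerminal_mapAlong_equiv_iff G e _ _ _ _).mpr hCT)
  · exact (DPSCData.ofEmbedding G E ι hιr hιn PiI hIn hle).isSlimGroup_vertSub_of_psc
      (G.mapAlong e.toMulEquiv.toMonoidHom e.continuous G.Sigma subset_rfl G.sigma_nonempty
        (G.proSigma.of_continuousMulEquiv e))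
      Equiv.ulift (DPSCData.vertSub_presentation G E ι hιr hιn PiI hIn hle he) hslim'

end Embedding

section OuterAction

variable {P : Type u} [Group P] [TopologicalSpace P] [IsTopologicalGroup P] [CompactSpace P]
  [TotallyDisconnectedSpace P] (G : PSCDatum P) (hG : IsTopologicallyFinitelyGenerated P)
  (hZ : Subgroup.center P = ⊥)
  {J : Type u} [Group J] [TopologicalSpace J] [IsTopologicalGroup J] [CompactSpace J]
  [TotallyDisconnectedSpace J] (θ : J →ₜ* outProfinite hG) (I : Subgroup J) [I.Normal]
  (σ : G.graph.N → ℕ) (hσ : ∀ e, IsSigmaInteger G.Sigma (σ e))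

include hZ

/-- **`Prop_1_3_iii″` at the DPSC-extension `Π_𝒢 ⋊^out_θ J` of construction data from hypotheses on the
construction data ONLY**: [CombGC] Prop 1.2 (ii) for `G` (F-0438); slimness of the verticial subgroups
(Rmk 1.1.3); Π_v-fixing lifts of `ρ_I` (profinite Dehn twists, [CbTpII] Def 4.4); `I` closed with `I ≅ Ẑ^Σ`.
[cite: MochizukiAbsTopII2013, Prop 1.3 (iii) p.11] [cite: MochizukiCombGC2007, Prop 1.2 p.8] -/
theorem prop_1_3_iii''_ofOuterAction_of_dehn
    (hCT : G.VerticialEdgeLikeCommensurablyTerminal) (hslimv : ∀ w, IsSlimGroup ↥(G.vertGp w))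
    (hDehn : ∀ (v : G.graph.V) (i : J), i ∈ I → ∃ φ : P ≃ₜ* P,
      TopOut.mk P ⟨φ.toMulEquiv, (mem_contMulAut P).mpr ⟨φ.continuous, φ.symm.continuous⟩⟩ =
        outerActionOfContinuous hG θ i ∧ ∀ x ∈ G.vertGp v, φ x = x)
    (hIc : IsClosed (I : Set J)) (hI : IsFreeProSigmaCyclic G.Sigma ↥I) :
    Literature.AnabelianGeometry.AbsoluteAnabelian.AbsTopII.DPSCIndexData.Prop_1_3_iii''
      (ofOuterAction G hG θ I σ hσ) :=
  prop_1_3_iii''_ofEmbedding G _ _ (inlProfinite hG θ).continuous (inlProfinite_injective hG θ hZ) _ _ _ _ _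
    σ hσ hCT hslimv
    (fun v => DPSCData.Iv_sup_PiG_eq_PiI_ofOuterAction G hG θ I v (fun i hi => hDehn v.down i hi))
    (DPSCData.isFreeProSigmaCyclic_Iv_ofOuterAction G hG θ I hIc
      (DPSCData.prop13iii_ofOuterAction_of_fixing_lifts G hG hZ θ I hCT hslimv hDehn) hI)

end OuterAction

end AbsTopII.DPSCIndexData

end Literature.AnabelianGeometry.AbsoluteAnabelian

end
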